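import Summits.Ventures.LatticeQCDFlow.Scaling.GraphSchemeOneLevelModes
import Summits.Ventures.LatticeQCDFlow.Scaling.HomLadderWilsonFloor

/-!
HONEST FRAMING: exact (Metropolis-corrected) sampling algorithms for lattice gauge theory; figures
of merit are autocorrelation/cost numbers at stated couplings and volumes; no continuum-physics
claim.

# GraphSchemeWilsonFloor — WILSON'S FLOOR FOR A HOMOGENEOUS EXCHANGE SCHEME ON ANY SWAP LIST, FROM A SOLUTION OF THE VERTEX EQUATIONS:
# **`((1−ρ)/ρ)·log((1−ν(u))|Σ_kc_k|/(4D)) ≤ t_mix(1/4)`** WHENEVER `Qc = (1−ρ)c` (`0 < ρ < 1`) AND `D² ≥ (tΔ + (1−t)w_0c_0²)/ρ` (lean-2 GEN-47, ours)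

Venture-side (OURS).  Cell `lqcd-flow` (pub-lqcd), unit `pub-lqcd-lean-2-g47`, 2026-08-31.  Chapter AH (the hub–ladder interpolation), file 2 — the abstract floor.  Setting of file 1: swap list `e`
with distinct endpoints, identity maps, one positive law `ν`, the weighted scheme `P = t·ptGraphSwap ν^{⊗} e 1 + (1−t)·prodKernel w M` with exact hot sampler and idle cold kernels,
`0 < t < 1`.  INPUT: a real vector `c` on the levels and a rate `0 < ρ < 1` solving the vertex equations of file 1 (`Qc = (1−ρ)c`, `Q = I − (t/m)L_G − (1−t)w_0e_0e_0ᵀ`), a bound `Δ` on the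
squared differences of `c` across listed pairs, and convergence of the scheme (hypothesis `hconv`; discharged for lists containing the hub by chapter K file 6, for the path by chapter AG
file 3).  OUTPUT (chapter AF file 1 at defect `0`): from the constant start `(u,…,u)` the exact eigenfunction `Σ_kc_k(𝟙{x_k=u} − ν(u))` has value `(1−ν(u))Σ_kc_k`, and
`t_mix(1/4) ≥ ((1−ρ)/ρ)·log((1−ν(u))|Σ_kc_k|/(4D))` for every `D > 0` with `D² ≥ (tΔ + (1−t)w_0c_0²)/ρ`.  The path (chapter AG files 1, 3: `1/ρ ≥ K(2K+1)²/(π²t)`, `D² = 5(K+1)`) and the star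
(file 3 to come: `1/ρ ≈ K(t+h)/(th)`) are instances; for a general connected swap graph the positive ground state of `Q` is the input (OPEN-MATH GEN-47 (iv)).  No definitions.

* `graphScheme_isRowStochastic`, `graphScheme_detailedBalance`, **`graphScheme_mode_mixingTime_ge`**.

Literature grade (cell rule): OWN (LPW §13.5 ∕ Wilson 2004 mechanism via chapter AF file 1); nothing cited; no new bib keys.
-/

noncomputable section

open Finset Function Real
open Literature.Probability.MarkovChains

namespace Summit.Ventures.LatticeQCDFlow.Scaling

variable {S : Type*} [Fintype S] [DecidableEq S] {K m : ℕ} {ν : S → ℝ} {M : Fin (K + 1) → S → S → ℝ} {w : Fin (K + 1) → ℝ} {t : ℝ}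
  {P : (Fin (K + 1) → S) → (Fin (K + 1) → S) → ℝ}

section Graph
variable (e : Fin m → Fin (K + 1) × Fin (K + 1))

/-- The homogeneous graph scheme is a transition matrix (`0 ≤ t ≤ 1`, `w` a probability vector). [ours] -/
theorem graphScheme_isRowStochastic (hν : ∀ v, 0 < ν v) (hν1 : ∑ v, ν v = 1) (hM0 : ∀ u v, M 0 u v = ν v)
    (hidle : ∀ i : Fin K, ∀ u v, M i.succ u v = if v = u then 1 else 0) (hw0 : ∀ k, 0 ≤ w k) (hw1 : ∑ k, w k = 1) (ht0 : 0 ≤ t) (ht1 : t ≤ 1)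
    (hP : ∀ x y, P x y = t * ptGraphSwap (fun _ : Fin (K + 1) => ν) e (fun _ => Equiv.refl S) x y + (1 - t) * prodKernel w M x y) : IsRowStochastic P := by
  have hμ : ∀ (k : Fin (K + 1)) (v : S), 0 < (fun _ : Fin (K + 1) => ν) k v := fun _ v => hν v
  have h := weightedScheme_isRowStochastic (t := t) (w := w) (ptGraphSwap_isRowStochastic (e := e) (φ := fun _ => Equiv.refl S) hμ)
    (homLadder_kernels hν hν1 hM0 hidle).1 hw0 hw1 ht0 ht1
  have eP : P = fun x y => t * ptGraphSwap (fun _ : Fin (K + 1) => ν) e (fun _ => Equiv.refl S) x y + (1 - t) * prodKernel w M x y :=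
    funext fun x => funext fun y => hP x y
  rw [eP]; exact h

/-- The homogeneous graph scheme is in detailed balance with `ν^{⊗(K+1)}`. [ours] -/
theorem graphScheme_detailedBalance (hν : ∀ v, 0 < ν v) (hν1 : ∑ v, ν v = 1) (hM0 : ∀ u v, M 0 u v = ν v)
    (hidle : ∀ i : Fin K, ∀ u v, M i.succ u v = if v = u then 1 else 0)
    (hP : ∀ x y, P x y = t * ptGraphSwap (fun _ : Fin (K + 1) => ν) e (fun _ => Equiv.refl S) x y + (1 - t) * prodKernel w M x y) :
    DetailedBalance (tensorFun (fun _ : Fin (K + 1) => ν)) P := by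
  have hμ : ∀ (k : Fin (K + 1)) (v : S), 0 < (fun _ : Fin (K + 1) => ν) k v := fun _ v => hν v
  have h := weightedScheme_detailedBalance (w := w) (ptGraphSwap_detailedBalance (e := e) (φ := fun _ => Equiv.refl S) hμ) (homLadder_kernels hν hν1 hM0 hidle).2 t
  have eP : P = fun x y => t * ptGraphSwap (fun _ : Fin (K + 1) => ν) e (fun _ => Equiv.refl S) x y + (1 - t) * prodKernel w M x y :=
    funext fun x => funext fun y => hP x y
  rw [eP]; exact h

/-- **WILSON'S FLOOR FROM THE VERTEX EQUATIONS, ANY SWAP LIST:** `m ≥ 1`, distinct endpoints, `0 < t < 1`, `w` a probability vector, one positive law `ν`, exact hot sampler, idle cold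
kernels; `c`, `ρ` with `Qc = (1−ρ)c` (the vertex equations of file 1), `0 < ρ < 1`, `(c_{i_r} − c_{l_r})² ≤ Δ` on every listed pair, the scheme `¼`-close at some time, `D > 0` with
`(tΔ + (1−t)w_0c_0²)/ρ ≤ D²`; then for every content `u`: **`((1−ρ)/ρ)·log((1−ν(u))·|Σ_kc_k|/(4D)) ≤ t_mix(1/4)`**. [ours] -/
theorem graphScheme_mode_mixingTime_ge (hm : 1 ≤ m) (he : ∀ r, (e r).1 ≠ (e r).2) (hν : ∀ v, 0 < ν v) (hν1 : ∑ v, ν v = 1)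
    (hM0 : ∀ u v, M 0 u v = ν v) (hidle : ∀ i : Fin K, ∀ u v, M i.succ u v = if v = u then 1 else 0) (hw0 : ∀ k, 0 ≤ w k) (hw1 : ∑ k, w k = 1)
    (ht0 : 0 < t) (ht1 : t < 1)
    (hP : ∀ x y, P x y = t * ptGraphSwap (fun _ : Fin (K + 1) => ν) e (fun _ => Equiv.refl S) x y + (1 - t) * prodKernel w M x y)
    {c : Fin (K + 1) → ℝ} {ρ Δ : ℝ}
    (hvertex : ∀ k : Fin (K + 1), t / m * ∑ r : Fin m, ((if k = (e r).1 then c (e r).2 - c (e r).1 else 0) + (if k = (e r).2 then c (e r).1 - c (e r).2 else 0))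
      - (if k = 0 then (1 - t) * w 0 * c 0 else 0) = -ρ * c k)
    (hρ0 : 0 < ρ) (hρ1 : ρ < 1) (hΔ : ∀ r : Fin m, (c (e r).1 - c (e r).2) ^ 2 ≤ Δ)
    (hconv : ∃ t₀, worstTvDist P (tensorFun (fun _ : Fin (K + 1) => ν)) t₀ ≤ 1 / 4)
    {D : ℝ} (hD0 : 0 < D) (hD : (t * Δ + (1 - t) * w 0 * c 0 ^ 2) / ρ ≤ D ^ 2) (u : S) :
    (1 - ρ) / ρ * Real.log ((1 - ν u) * |∑ k : Fin (K + 1), c k| / (4 * D)) ≤ (mixingTime P (tensorFun (fun _ : Fin (K + 1) => ν)) (1 / 4) : ℝ) := by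
  have hμ : ∀ (k : Fin (K + 1)) (v : S), 0 < (fun _ : Fin (K + 1) => ν) k v := fun _ v => hν v
  -- the statistic
  set a : S → ℝ := fun v => (if v = u then (1 : ℝ) else 0) - ν u with ha_def
  set Φ : (Fin (K + 1) → S) → ℝ := fun x => ∑ k : Fin (K + 1), c k * a (x k) with hΦ_def
  have hΦ : ∀ x, Φ x = ∑ k : Fin (K + 1), c k * a (x k) := fun x => rfl
  have ha0 : ∑ v, ν v * a v = 0 := centredIndicator_mean hν1 u
  have ha : ∀ v v', (a v - a v') ^ 2 ≤ 1 := fun v v' => centredIndicator_diff_sq_le ν u v v'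
  have heig : ∀ x, ∑ y, P x y * Φ y = (1 - ρ) * Φ x := graphScheme_oneLevel_eigen e hm he hν hν1 hM0 hidle hw1 hP ha0 hΦ hvertex
  have heig' : ∀ x, |∑ y, P x y * Φ y - (1 - ρ) * Φ x| ≤ 0 := fun x => by rw [heig x, sub_self, abs_zero]
  set R : ℝ := t * Δ + (1 - t) * w 0 * c 0 ^ 2 with hR_def
  have hΔ0 : 0 ≤ Δ := le_trans (sq_nonneg _) (hΔ ⟨0, by omega⟩)
  have hR0 : 0 ≤ R := by
    have h1 := hw0 0
    have h2 : 0 ≤ 1 - t := by linarith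
    rw [hR_def]; positivity
  have hR : ∀ x, ∑ y, P x y * (Φ y - Φ x) ^ 2 ≤ R := fun x =>
    graphScheme_oneLevel_increment_le e hm he hν hν1 hM0 hidle (hw0 0) hw1 ht0.le ht1.le hP hΦ hΔ ha x
  have hD' : (R + 2 * (0 : ℝ) ^ 2 / (1 - (1 - ρ))) / (1 - (1 - ρ)) ≤ D ^ 2 := by
    rw [show 1 - (1 - ρ) = ρ by ring, show R + 2 * (0 : ℝ) ^ 2 / ρ = R by simp]; exact hD
  -- the chain
  have hPst := graphScheme_isRowStochastic e hν hν1 hM0 hidle hw0 hw1 ht0.le ht1.le hP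
  have hst := (graphScheme_detailedBalance e hν hν1 hM0 hidle hP).isStationary hPst.2
  have hπ0 : ∀ x, 0 ≤ tensorFun (fun _ : Fin (K + 1) => ν) x := fun x => (tensorFun_pos hμ x).le
  have hπ1 : ∑ x, tensorFun (fun _ : Fin (K + 1) => ν) x = 1 := sum_tensorFun_eq_one _ fun _ => hν1
  have hW := approxEigen_mixingTime_ge (Φ := Φ) (lam := 1 - ρ) (δ := 0) (R := R) hPst heig' (by linarith) (by linarith) hR0 hR hπ0 hπ1 hst hconv hD0 hD'
    (fun _ : Fin (K + 1) => u)
  -- the start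
  have hΦ0 : Φ (fun _ : Fin (K + 1) => u) = (1 - ν u) * ∑ k : Fin (K + 1), c k := by
    rw [hΦ, mul_sum]
    exact sum_congr rfl fun k _ => by rw [ha_def]; simp only [if_true]; ring
  have habs : |Φ (fun _ : Fin (K + 1) => u)| = (1 - ν u) * |∑ k : Fin (K + 1), c k| := by
    rw [hΦ0, abs_mul, abs_of_nonneg]
    have : ν u ≤ 1 := by
      calc ν u ≤ ∑ v, ν v := Finset.single_le_sum (fun v _ => (hν v).le) (mem_univ u)
        _ = 1 := hν1
    linarith
  rw [show 2 * (0 : ℝ) / (1 - (1 - ρ)) + 4 * D = 4 * D by ring, show (1 - ρ) / (1 - (1 - ρ)) = (1 - ρ) / ρ by ring, habs] at hW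
  exact hW

end Graph

end Summit.Ventures.LatticeQCDFlow.Scaling

end
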